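import Summits.CriticalPhenomena.PercolationContinuityZ3.Theorems.PercNearOneGluingNoHeavyQuantFarPendantTree
import HarnessLib

/-!
# QUANT lane R8, front "FAR beyond trees", layer one — **two pendant relay leaves at one vertex force FAR at layer one, in ANY graph**

builds on p205010 (kernel theorem, internal audit signed; external expert review pending)

Support file (`--supports stmt-CriticalPhenomena-4575`), seat `prim-quant-p1` (gen 24); memo
`run/shared/lean/prim/quant/prim-quant-p1-g24/FOR-LEAD-INTRINSIC.md` §8.  Standard axioms; no sorries; no definitions.

The simplest instance of `Block.layerOne_of_pendantTree` (this seat), stated without any tree bookkeeping: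
* `Block.layerOne_of_pendantLeaves` — let `w` be ANY weight function on the pairs of `Fin n`, `o` an observer, `A` a relay set; let `L` be a set
  of PENDANT LEAVES of a vertex `c` (`o, c ∉ L`; every pair at a leaf `ℓ ∈ L` other than `s(c, ℓ)` and the loop has weight `0`) containing two
  distinct relays of `A`.  Then the layer-one far-relay row holds at `o`: `2 < Σ_{a∈A} P(o ↔ a)` and `P(o ↮ a) ≤ t` on `A` imply
  `P_w(#{a ∈ A : o ↔ a} ≤ 1) ≤ t`.
So a single cherry of relays anywhere in a graph — however far from the observer, whatever the rest of the graph (2-connected, dense, …) —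
puts the whole instance inside the proved part of `Quant.FarRelayRow` at layer one.  (The leaves form the pendant tree `Z = L`, `par = c`,
`dep = 0`; the least internal marginal is attained on the finite set `A ∩ L`.)
[cite: Grimmett1999, §1.3 p. 10] (product measure); [cite: KozmaNitzan2024, Conjecture 3 (p. 15)] (FAR is the `j = 1` far-relay row); [this work].
-/

noncomputable section

namespace Summit.CriticalPhenomena.PercolationContinuityZ3.Theorems

namespace Quant

namespace Block

open Finset MeasureTheory Set
open Literature.Probability.LatticeModels
open Literature.Probability.Percolation
open Bundle (offZ avoid)
open scoped Classical

variable {n : ℕ}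

/-- **Two pendant relay leaves at one vertex force FAR at layer one.**  `L` = pendant leaves of `c` (`o, c ∉ L`; at each `ℓ ∈ L` only the pair
`s(c, ℓ)` and the loop may carry weight), `a₁ ≠ a₂ ∈ A ∩ L`.  Then `2 < Σ_{a∈A} P(o ↔ a)` and `P(o ↮ a) ≤ t` on `A` give
`P_w(#{a ∈ A : o ↔ a} ≤ 1) ≤ t`, with no hypothesis on the rest of the graph. [this work] -/
theorem layerOne_of_pendantLeaves (w : Sym2 (Fin n) → unitInterval) {o c : Fin n} {L : Finset (Fin n)} (ho : o ∉ L) (hc : c ∉ L)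
    (hL : ∀ ℓ ∈ L, ∀ y : Fin n, y ≠ ℓ → y ≠ c → w s(ℓ, y) = 0)
    (A : Finset (Fin n)) (t : ℝ) {a₁ a₂ : Fin n} (ha₁ : a₁ ∈ A ∩ L) (ha₂ : a₂ ∈ A ∩ L) (hne : a₁ ≠ a₂)
    (hEN : (2 : ℝ) < ∑ a ∈ A, (prodBernoulli w).real (openConn o a))
    (hcut : ∀ a ∈ A, (prodBernoulli w).real (openConn o a)ᶜ ≤ t) :
    (prodBernoulli w).real {ω : BondConfig (Fin n) | (A.filter fun a => ω ∈ openConn o a).card ≤ 1} ≤ t := by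
  -- the leaves hang at `c` and form the pendant tree `par = c`, `dep = 0`
  have hw : ∀ x y : Fin n, x ≠ y → x ∈ L → y ∉ L → y ≠ c → (w s(x, y) : ℝ) = 0 := by
    intro x y hxy hx _ hyc
    rw [hL x hx y (Ne.symm hxy) hyc]; rfl
  have hpar0 : ∀ z ∈ L, (fun _ : Fin n => (0 : ℕ)) z = 0 → (fun _ : Fin n => c) z = c := fun _ _ _ => rfl
  have hparS : ∀ z ∈ L, (fun _ : Fin n => (0 : ℕ)) z ≠ 0 →
      (fun _ : Fin n => c) z ∈ L ∧ (fun _ : Fin n => (0 : ℕ)) ((fun _ : Fin n => c) z) + 1 = (fun _ : Fin n => (0 : ℕ)) z :=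
    fun _ _ h => absurd rfl h
  have hsuppZ : ∀ e : Sym2 (Fin n), e ∉ avoid L → w e ≠ 0 → e.IsDiag ∨ ∃ z ∈ L, e = s((fun _ : Fin n => c) z, z) := by
    intro e he hwe
    induction e using Sym2.ind with
    | h x y =>
      -- one endpoint is a leaf
      have hxy : x ∈ L ∨ y ∈ L := by
        by_contra hcon
        apply he
        rw [Bundle.avoid, Finset.mem_filter]
        refine ⟨Finset.mem_univ _, fun z hz hzm => ?_⟩
        rcases Sym2.mem_iff.1 hzm with rfl | rfl
        · exact hcon (Or.inl hz)
        · exact hcon (Or.inr hz)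
      by_cases hd : x = y
      · left; exact Sym2.mk_isDiag_iff.2 hd
      · right
        rcases hxy with hx | hy
        · by_cases hyc : y = c
          · exact ⟨x, hx, by rw [hyc, Sym2.eq_swap]⟩
          · exact absurd (hL x hx y (Ne.symm hd) hyc) hwe
        · by_cases hxc : x = c
          · exact ⟨y, hy, by rw [hxc]⟩
          · exfalso; apply hwe; rw [Sym2.eq_swap]; exact hL y hy x hd hxc
  -- the relay of least internal marginal among `A ∩ L`
  obtain ⟨a₀, ha₀, hmin⟩ := Finset.exists_min_image (A ∩ L)
    (fun a => (prodBernoulli w).real {ω | onZ L ω ∈ openConn c a}) ⟨a₁, ha₁⟩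
  -- a second relay distinct from `a₀`
  have hother : ∃ a', a' ∈ A ∩ L ∧ a₀ ≠ a' := by
    by_cases h : a₀ = a₁
    · exact ⟨a₂, ha₂, h ▸ hne⟩
    · exact ⟨a₁, ha₁, h⟩
  obtain ⟨a', ha', hne'⟩ := hother
  exact layerOne_of_pendantTree w ho hc hw (fun _ => c) (fun _ => 0) hpar0 hparS hsuppZ A t ha₀ ha' hne' hmin hEN hcut

end Block

end Quant

end Summit.CriticalPhenomena.PercolationContinuityZ3.Theorems
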